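import Summits.HodgeConjecture.HodgeConjecture.Theorems.F0P3SemilocalTestFunctionsOfRecord   -- ★ `TestS₀`, `tens₀`, `toPureTensor`, `coe_tens₀` (tokens of record)
import Summits.HodgeConjecture.HodgeConjecture.Theorems.F0P2aCmFrameFactorisation            -- ★ `mem_cmCompactFactor_iff`, `mul_finAdelicToAdelic_of_mem_cmCompactFactor`
import Literature.NumberTheory.Automorphic.UnitaryGroupPureTensorContinuity                   -- ★ `toLocal_archToAdelic`
import HarnessLib

/-!
# Crux `H413` — (O1) TF pay-down `Lines/F0_P3_TraceFactorisationPaydown.lean`, stub (D) `stub_KcIdempotent`, CM-FRAME INPUTS (D-cm):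
# the compact archimedean factor `Kc = cmCompactFactor L ι H T hT` is NORMAL in `U(H)(𝔸_{L⁺})`, and the test tensor of record
# `tens₀ S fS fT = f′_{S,∞} ⊗ f^S` is LEFT and RIGHT `Kc`-INVARIANT

Cell `hodgecm-mathlib`, floor 0, programme F0∕P3 «U3-mult», crux item `stmt-HodgeConjecture-24833` (`HCCMUnconditional.H413`); director s561 (2) ∕ s568,
F0P3-plan (g6) desk order (b) 14:23:02Z; (O1) drafter F0P3-p01 (g9) design 14:25:21Z; stub (D) holder A-p01 (g17) (census 14:27:24Z: (D-gen) generic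
`IntegratedOperatorFixedVectors` + (D-leaf) head); this file = the DEPTH hand A-p12 (g16)'s two CM-frame inputs named in that census, in the tokens of record,
measure-free and kit-free.  THEOREMS ONLY (no `def`, no instance, no notation, no named fact, no `sorry`); `--supports stmt-HodgeConjecture-24833 --as helper`.

* §1 `mem_cmCompactFactor_iff_finPart_archPart` — `k ∈ Kc ↔ k_f = 1 ∧ pr_ι(k_∞) = 1`; **`cmCompactFactor_normal : (cmCompactFactor L ι H T hT).Normal`**
  (both conditions are kernel conditions of homomorphisms) [BorelJacquet1979 §4.1: `G(𝔸) = G_∞ × G(𝔸_f)`, `G_∞ = ∏_w G_w`].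
* §2 local and archimedean components of `k ∈ Kc`: `toLocal_eq_one_of_mem_cmCompactFactor` (`k_v = 1` at every finite `v`), `archToAdelic_archPart_of_mem_cmCompactFactor`.
* §3 **`tens₀_apply_mul_of_mem_cmCompactFactor`** (`(f′_{S,∞} ⊗ f^S)(x k) = (f′_{S,∞} ⊗ f^S)(x)`), `…_mul_inv_…`, **`tens₀_apply_of_mem_cmCompactFactor_mul`**
  (`(f′_{S,∞} ⊗ f^S)(k x) = …(x)`) for `k ∈ Kc` — from the two `Kc`-invariance fields of ★ `TestS₀` (`arch_mul_archPart`, `arch_archPart_mul`, RULING (V31)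
  «`f′_∞ = f_ι ⊗ e_{Kc}`») through ★ `PureTensor.eval` (the finite local components of `x k` and `x` agree, §2).
These are exactly the inputs «`(cmCompactFactor L ι H T hT).Normal`» and «right-`Kc`-invariance of `⇑(tens₀ S fS fT)`» of the (D-leaf) road; the holder cites them by name.
HONEST LABEL: HC_CM is proved only modulo the 2 remaining named inputs (hLiu418, h413) — behind them 26 booked printed statements + the MOD package — until rung 0
closes; this file discharges none of them (elementary group bookkeeping in the frame).
References: [BorelJacquet1979] A. Borel, H. Jacquet, PSPM 33.1 (1979) §4.1; [Rogawski1990] J. Rogawski, Ann. of Math. Stud. 123 (1990) §14.2 p. 233, §14.6 p. 244.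
-/

set_option autoImplicit false
-- the mandated namespace has the single-problem summit's repeated segment (`HodgeConjecture.HodgeConjecture`)
set_option linter.dupNamespace false

noncomputable section

namespace Summit.HodgeConjecture.HodgeConjecture.Cruxes.H413.F0P3TraceFactorisationKcInvariance

open NumberField IsDedekindDomain
open scoped Matrix
open Literature.NumberTheory.Automorphic Literature.NumberTheory.Automorphic.UnitaryGroup
open Literature.NumberTheory.Automorphic.UnitaryGroup.CotangentForms (cmCompactFactor)
open Summit.HodgeConjecture.HodgeConjecture.Cruxes.H413.F0P3InnerFormClassificationV5 (Places)
open Summit.HodgeConjecture.HodgeConjecture.Cruxes.H413.F0P3TestFunctionsOfRecord (Unr₀)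
open Summit.HodgeConjecture.HodgeConjecture.Cruxes.H413.F0P3SemilocalTestFunctionsOfRecord (TestS₀ tens₀ toPureTensor coe_tens₀ toPureTensor_arch)
open Summit.HodgeConjecture.HodgeConjecture.Cruxes.H413.F0P2aCmFrameFactorisation (mem_cmCompactFactor_iff)

variable (L : Type) [Field L] [NumberField L] [IsCMField L] (ι : L →+* ℂ) (H : Matrix (Fin 3) (Fin 3) L) (T : GL (Fin 3) ℂ)
  (hT : (T : Matrix (Fin 3) (Fin 3) ℂ)ᴴ * H.map ι * (T : Matrix (Fin 3) (Fin 3) ℂ) = Literature.Geometry.ComplexHyperbolic.BallModel.J)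

/-! ## §1 `Kc` by its two components; normality -/

/-- **`k ∈ Kc ↔ k_f = 1 ∧ pr_ι(k_∞) = 1`**: the compact archimedean factor is cut out by the two homomorphisms `finPart` (★ `UnitaryGroupAdelicProduct`)
and `archProjU21EmbCM ∘ archPart` (★ `UnitaryGroupArchProjectionEmb`). [cite: BorelJacquet1979, §4.1] -/
theorem mem_cmCompactFactor_iff_finPart_archPart
    (k : (adelicGroupData (↥(maximalRealSubfield L)) L (IsCMField.complexConj L) 3 H).Adelic) :
    k ∈ cmCompactFactor L ι H T hT ↔
      finPart (↥(maximalRealSubfield L)) L (IsCMField.complexConj L) 3 H k = 1 ∧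
        archProjU21EmbCM L H ι T (formCongr_eq_of_conjTranspose L ι H T hT)
          (archPart (↥(maximalRealSubfield L)) L (IsCMField.complexConj L) 3 H k) = 1 := by
  rw [mem_cmCompactFactor_iff]
  constructor
  · rintro ⟨a, ha, rfl⟩
    exact ⟨finPart_archToAdelic _ _ _ _ _ a, by rwa [archPart_archToAdelic]⟩
  · rintro ⟨hf, ha⟩
    refine ⟨archPart (↥(maximalRealSubfield L)) L (IsCMField.complexConj L) 3 H k, ha, ?_⟩
    have h := archToAdelic_mul_finAdelicToAdelic (↥(maximalRealSubfield L)) L (IsCMField.complexConj L) 3 H k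
    rwa [hf, map_one, mul_one] at h

/-- **(cm-1) `Kc = cmCompactFactor L ι H T hT` IS A NORMAL SUBGROUP OF `U(H)(𝔸_{L⁺})`** (it is the intersection of two kernels, §1; in print: `Kc = ∏_{w ≠ w(ι)} U(H)(L_w)` is a
direct factor of `G(𝔸) = G_ι × Kc × G(𝔸_f)`). [cite: BorelJacquet1979, §4.1] [cite: Rogawski1990, §14.6 p. 244] -/
theorem cmCompactFactor_normal : (cmCompactFactor L ι H T hT).Normal := by
  refine ⟨fun n hn g => ?_⟩
  rw [mem_cmCompactFactor_iff_finPart_archPart] at hn ⊢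
  refine ⟨?_, ?_⟩
  · rw [map_mul, map_mul, hn.1, mul_one, map_inv, mul_inv_cancel]
  · rw [map_mul, map_mul, map_mul, map_mul, hn.2, mul_one, map_inv, map_inv, mul_inv_cancel]

/-! ## §2 The components of an element of `Kc` (arguments typed on `(cmDatum L 3 H).Adelic`, the carrier of ★ `tens₀` ∕ ★ `PureTensor.eval` ∕ the `TestS₀` fields; `cmDatum L 3 H = Gp L H` is `rfl`) -/

variable {L ι H T hT}

/-- For `k ∈ Kc`: `k = (k_∞, 1)`, i.e. `archToAdelic (archPart k) = k`. [cite: BorelJacquet1979, §4.1] -/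
theorem archToAdelic_archPart_of_mem_cmCompactFactor
    {k : (cmDatum L 3 H).Adelic} (hk : k ∈ cmCompactFactor L ι H T hT) :
    archToAdelic (↥(maximalRealSubfield L)) L (IsCMField.complexConj L) 3 H
        (archPart (↥(maximalRealSubfield L)) L (IsCMField.complexConj L) 3 H k) = k := by
  obtain ⟨a, -, rfl⟩ := (mem_cmCompactFactor_iff L ι H T hT k).1 hk
  rw [archPart_archToAdelic]

/-- For `k ∈ Kc` the archimedean part lies in the kernel of the projection at `ι`: `pr_ι(k_∞) = 1`. [cite: BorelJacquet1979, §4.1] -/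
theorem archProjU21EmbCM_archPart_of_mem_cmCompactFactor
    {k : (cmDatum L 3 H).Adelic} (hk : k ∈ cmCompactFactor L ι H T hT) :
    archProjU21EmbCM L H ι T (formCongr_eq_of_conjTranspose L ι H T hT)
        (archPart (↥(maximalRealSubfield L)) L (IsCMField.complexConj L) 3 H k) = 1 :=
  ((mem_cmCompactFactor_iff_finPart_archPart L ι H T hT k).1 hk).2

/-- For `k ∈ Kc` the finite part is trivial: `k_f = 1`. [cite: BorelJacquet1979, §4.1] -/
theorem finPart_of_mem_cmCompactFactor
    {k : (cmDatum L 3 H).Adelic} (hk : k ∈ cmCompactFactor L ι H T hT) :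
    finPart (↥(maximalRealSubfield L)) L (IsCMField.complexConj L) 3 H k = 1 :=
  ((mem_cmCompactFactor_iff_finPart_archPart L ι H T hT k).1 hk).1

/-- **Every finite local component of `k ∈ Kc` is trivial**: `k_v = 1` in `U(H)(L⁺_v)` (★ `toLocal_archToAdelic`). [cite: BorelJacquet1979, §4.1] -/
theorem toLocal_eq_one_of_mem_cmCompactFactor
    {k : (cmDatum L 3 H).Adelic} (hk : k ∈ cmCompactFactor L ι H T hT)
    (v : Places L) : (cmDatum L 3 H).toLocal v k = 1 := by
  obtain ⟨a, -, rfl⟩ := (mem_cmCompactFactor_iff L ι H T hT k).1 hk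
  exact toLocal_archToAdelic (↥(maximalRealSubfield L)) L (IsCMField.complexConj L) 3 H v a

/-- Hence the finite local components of `x * k` and of `x` agree for `k ∈ Kc`. [cite: BorelJacquet1979, §4.1] -/
theorem toLocal_mul_of_mem_cmCompactFactor
    {k : (cmDatum L 3 H).Adelic} (hk : k ∈ cmCompactFactor L ι H T hT)
    (v : Places L) (x : (cmDatum L 3 H).Adelic) : (cmDatum L 3 H).toLocal v (x * k) = (cmDatum L 3 H).toLocal v x := by
  rw [map_mul, toLocal_eq_one_of_mem_cmCompactFactor hk, mul_one]

/-- … and those of `k * x` and of `x`. [cite: BorelJacquet1979, §4.1] -/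
theorem toLocal_mul_left_of_mem_cmCompactFactor
    {k : (cmDatum L 3 H).Adelic} (hk : k ∈ cmCompactFactor L ι H T hT)
    (v : Places L) (x : (cmDatum L 3 H).Adelic) : (cmDatum L 3 H).toLocal v (k * x) = (cmDatum L 3 H).toLocal v x := by
  rw [map_mul, toLocal_eq_one_of_mem_cmCompactFactor hk, one_mul]

/-! ## §3 `Kc`-invariance of pure tensors with a `Kc`-invariant archimedean factor, and of `tens₀ S fS fT` -/

/-- `archPart` is multiplicative on `(cmDatum L 3 H).Adelic`-typed arguments (★ `archPart` is a homomorphism of `(Gp L H).Adelic`; `cmDatum L 3 H = Gp L H` is `rfl`,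
recorded here so that `simp` sees the product through the `cmDatum` instance path). [cite: BorelJacquet1979, §4.1] -/
theorem archPart_mul_cmDatum (x y : (cmDatum L 3 H).Adelic) :
    archPart (↥(maximalRealSubfield L)) L (IsCMField.complexConj L) 3 H (x * y) =
      archPart (↥(maximalRealSubfield L)) L (IsCMField.complexConj L) 3 H x * archPart (↥(maximalRealSubfield L)) L (IsCMField.complexConj L) 3 H y :=
  map_mul (archPart (↥(maximalRealSubfield L)) L (IsCMField.complexConj L) 3 H) x y

/-- **A pure tensor whose archimedean factor is right-invariant under `k_∞` is right-invariant under `k ∈ Kc`** (the finite local components of `x k` and `x`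
agree, §2; ★ `PureTensor.eval`). [cite: Rogawski1990, §14.2 p. 233] [cite: BorelJacquet1979, §4.1] -/
theorem pureTensor_eval_mul_of_mem_cmCompactFactor (P : PureTensor L 3 H)
    {k : (cmDatum L 3 H).Adelic} (hk : k ∈ cmCompactFactor L ι H T hT)
    (hP : ∀ a, P.arch (a * archPart (↥(maximalRealSubfield L)) L (IsCMField.complexConj L) 3 H k) = P.arch a)
    (x : (cmDatum L 3 H).Adelic) : P.eval (x * k) = P.eval x := by
  have hiff : (∀ v ∉ P.S, (cmDatum L 3 H).toLocal v (x * k) ∈ P.K v) ↔ ∀ v ∉ P.S, (cmDatum L 3 H).toLocal v x ∈ P.K v :=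
    forall₂_congr fun v _ => by rw [toLocal_mul_of_mem_cmCompactFactor hk v x]
  by_cases h : ∀ v ∉ P.S, (cmDatum L 3 H).toLocal v x ∈ P.K v
  · rw [PureTensor.eval_eq_of_forall_mem P _ (hiff.2 h), PureTensor.eval_eq_of_forall_mem P _ h, archPart_mul_cmDatum, hP]
    exact congrArg _ (Finset.prod_congr rfl fun v _ => by rw [toLocal_mul_of_mem_cmCompactFactor hk v x])
  · push Not at h
    obtain ⟨v, hv, hx⟩ := h
    rw [PureTensor.eval_eq_zero_of_not_mem P _ hv (by rwa [toLocal_mul_of_mem_cmCompactFactor hk v x]),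
      PureTensor.eval_eq_zero_of_not_mem P _ hv hx]

/-- **… and left-invariant under `k ∈ Kc` when its archimedean factor is left-invariant under `k_∞`.** [cite: Rogawski1990, §14.2 p. 233] [cite: BorelJacquet1979, §4.1] -/
theorem pureTensor_eval_mul_left_of_mem_cmCompactFactor (P : PureTensor L 3 H)
    {k : (cmDatum L 3 H).Adelic} (hk : k ∈ cmCompactFactor L ι H T hT)
    (hP : ∀ a, P.arch (archPart (↥(maximalRealSubfield L)) L (IsCMField.complexConj L) 3 H k * a) = P.arch a)
    (x : (cmDatum L 3 H).Adelic) : P.eval (k * x) = P.eval x := by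
  have hiff : (∀ v ∉ P.S, (cmDatum L 3 H).toLocal v (k * x) ∈ P.K v) ↔ ∀ v ∉ P.S, (cmDatum L 3 H).toLocal v x ∈ P.K v :=
    forall₂_congr fun v _ => by rw [toLocal_mul_left_of_mem_cmCompactFactor hk v x]
  by_cases h : ∀ v ∉ P.S, (cmDatum L 3 H).toLocal v x ∈ P.K v
  · rw [PureTensor.eval_eq_of_forall_mem P _ (hiff.2 h), PureTensor.eval_eq_of_forall_mem P _ h, archPart_mul_cmDatum, hP]
    exact congrArg _ (Finset.prod_congr rfl fun v _ => by rw [toLocal_mul_left_of_mem_cmCompactFactor hk v x])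
  · push Not at h
    obtain ⟨v, hv, hx⟩ := h
    rw [PureTensor.eval_eq_zero_of_not_mem P _ hv (by rwa [toLocal_mul_left_of_mem_cmCompactFactor hk v x]),
      PureTensor.eval_eq_zero_of_not_mem P _ hv hx]

variable {S : Finset (Places L)}

/-- **(cm-2) `tens₀ S fS fT` IS RIGHT `Kc`-INVARIANT**: `(f′_{S,∞} ⊗ f^S)(x k) = (f′_{S,∞} ⊗ f^S)(x)` for `k ∈ Kc` (★ `TestS₀.arch_mul_archPart`: `f′_∞ = f_ι ⊗ e_{Kc}` is right
`Kc`-invariant, RULING (V31); the finite factors do not see `k`). [cite: Rogawski1990, §14.2 p. 233; §14.6 p. 244] [cite: BorelJacquet1979, §4.1] -/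
theorem tens₀_apply_mul_of_mem_cmCompactFactor (fS : TestS₀ L H ι T hT S) (fT : Unr₀ L H S)
    {k : (cmDatum L 3 H).Adelic} (hk : k ∈ cmCompactFactor L ι H T hT)
    (x : (cmDatum L 3 H).Adelic) : tens₀ S fS fT (x * k) = tens₀ S fS fT x := by
  rw [coe_tens₀]
  exact pureTensor_eval_mul_of_mem_cmCompactFactor (toPureTensor S fS fT) hk (fun a => fS.arch_mul_archPart k hk a) x

/-- The same in the `x k⁻¹` form (the substitution of the (D-gen) lemma `integratedOperator_comp_apply_eq`). [cite: BorelJacquet1979, §4.1] -/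
theorem tens₀_apply_mul_inv_of_mem_cmCompactFactor (fS : TestS₀ L H ι T hT S) (fT : Unr₀ L H S)
    {k : (cmDatum L 3 H).Adelic} (hk : k ∈ cmCompactFactor L ι H T hT)
    (x : (cmDatum L 3 H).Adelic) : tens₀ S fS fT (x * k⁻¹) = tens₀ S fS fT x :=
  tens₀_apply_mul_of_mem_cmCompactFactor fS fT (inv_mem hk) x

/-- **`tens₀ S fS fT` IS LEFT `Kc`-INVARIANT**: `(f′_{S,∞} ⊗ f^S)(k x) = (f′_{S,∞} ⊗ f^S)(x)` for `k ∈ Kc` (★ `TestS₀.arch_archPart_mul`).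
[cite: Rogawski1990, §14.2 p. 233; §14.6 p. 244] [cite: BorelJacquet1979, §4.1] -/
theorem tens₀_apply_of_mem_cmCompactFactor_mul (fS : TestS₀ L H ι T hT S) (fT : Unr₀ L H S)
    {k : (cmDatum L 3 H).Adelic} (hk : k ∈ cmCompactFactor L ι H T hT)
    (x : (cmDatum L 3 H).Adelic) : tens₀ S fS fT (k * x) = tens₀ S fS fT x := by
  rw [coe_tens₀]
  exact pureTensor_eval_mul_left_of_mem_cmCompactFactor (toPureTensor S fS fT) hk (fun a => fS.arch_archPart_mul k hk a) x

/-- Two-sided form: `(f′_{S,∞} ⊗ f^S)(k x k′) = (f′_{S,∞} ⊗ f^S)(x)` for `k, k′ ∈ Kc` — `f′_{S,∞} ⊗ f^S` is `Kc`-BI-INVARIANT. [cite: Rogawski1990, §14.6 p. 244] -/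
theorem tens₀_apply_mul_mul_of_mem_cmCompactFactor (fS : TestS₀ L H ι T hT S) (fT : Unr₀ L H S)
    {k k' : (cmDatum L 3 H).Adelic} (hk : k ∈ cmCompactFactor L ι H T hT)
    (hk' : k' ∈ cmCompactFactor L ι H T hT) (x : (cmDatum L 3 H).Adelic) : tens₀ S fS fT (k * x * k') = tens₀ S fS fT x := by
  rw [tens₀_apply_mul_of_mem_cmCompactFactor fS fT hk', tens₀_apply_of_mem_cmCompactFactor_mul fS fT hk]

/-! ## §4 The same three invariances with the arguments typed on `(Gp L H).Adelic = (adelicGroupData L⁺ L c̄ 3 H).Adelic` (the carrier of ★ `trGp₀`'s right-regular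
representation and of `cmCompactFactor`; definitionally the §3 statements — recorded so that the (D-leaf) `exact`s are syntactic) -/

/-- (cm-2) on `(Gp L H).Adelic`-typed arguments: `(f′_{S,∞} ⊗ f^S)(x k) = (f′_{S,∞} ⊗ f^S)(x)`, `k ∈ Kc`. [cite: Rogawski1990, §14.6 p. 244] -/
theorem tens₀_apply_mul_of_mem_cmCompactFactor' (fS : TestS₀ L H ι T hT S) (fT : Unr₀ L H S)
    {k : (adelicGroupData (↥(maximalRealSubfield L)) L (IsCMField.complexConj L) 3 H).Adelic} (hk : k ∈ cmCompactFactor L ι H T hT)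
    (x : (adelicGroupData (↥(maximalRealSubfield L)) L (IsCMField.complexConj L) 3 H).Adelic) : tens₀ S fS fT (x * k) = tens₀ S fS fT x :=
  tens₀_apply_mul_of_mem_cmCompactFactor fS fT (k := k) hk x

/-- (cm-2), `x k⁻¹` form, on `(Gp L H).Adelic`-typed arguments. [cite: Rogawski1990, §14.6 p. 244] -/
theorem tens₀_apply_mul_inv_of_mem_cmCompactFactor' (fS : TestS₀ L H ι T hT S) (fT : Unr₀ L H S)
    {k : (adelicGroupData (↥(maximalRealSubfield L)) L (IsCMField.complexConj L) 3 H).Adelic} (hk : k ∈ cmCompactFactor L ι H T hT)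
    (x : (adelicGroupData (↥(maximalRealSubfield L)) L (IsCMField.complexConj L) 3 H).Adelic) : tens₀ S fS fT (x * k⁻¹) = tens₀ S fS fT x :=
  tens₀_apply_mul_inv_of_mem_cmCompactFactor fS fT (k := k) hk x

/-- Left invariance on `(Gp L H).Adelic`-typed arguments: `(f′_{S,∞} ⊗ f^S)(k x) = (f′_{S,∞} ⊗ f^S)(x)`, `k ∈ Kc`. [cite: Rogawski1990, §14.6 p. 244] -/
theorem tens₀_apply_of_mem_cmCompactFactor_mul' (fS : TestS₀ L H ι T hT S) (fT : Unr₀ L H S)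
    {k : (adelicGroupData (↥(maximalRealSubfield L)) L (IsCMField.complexConj L) 3 H).Adelic} (hk : k ∈ cmCompactFactor L ι H T hT)
    (x : (adelicGroupData (↥(maximalRealSubfield L)) L (IsCMField.complexConj L) 3 H).Adelic) : tens₀ S fS fT (k * x) = tens₀ S fS fT x :=
  tens₀_apply_of_mem_cmCompactFactor_mul fS fT (k := k) hk x

end Summit.HodgeConjecture.HodgeConjecture.Cruxes.H413.F0P3TraceFactorisationKcInvariance

end
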